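import Literature.Probability.RandomPlanarGeometry.SLERestrictionHitPath
import HarnessLib

/-!
# Access arcs for smooth hulls (named facts)

Two pieces of elementary plane geometry of a smooth hull `A` (`IsSmoothHullWith A γ γ'`: a
bounded hull whose boundary in `ℍ` is the regular `C¹` Jordan arc `γ(0,1)`), vendored as named
facts (`def … : Prop`, not asserted) for the analytic proof of [LSW] Lemma 6.3 (the multi-scale
estimate `restrictionDeriv_le_pow` of `RestrictionDerivMultiScale`, now in the tree, and its
forthcoming assembly with `IsSmoothHull.hitPath_tendsto` / `hitPath_stolz`), to be discharged
separately:

* `IsSmoothHullWith.exists_smoothHitPath` — **existence of a smooth hit path**: at every point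
  `γ(s₀)`, `s₀ ∈ (0,1)`, of the boundary arc there is an injective `C¹` path `β : [0,1] → A`
  with `β[0,1) ⊆ int A`, `β(1) = γ(s₀)`, arriving along the normal (`IsSmoothHitPath`). (The
  inward normal segment `β(x) = γ(s₀) + (1 - x) ℓ n`, `n ⊥ γ'(s₀)` the inward unit normal,
  `ℓ` small, is one: a regular `C¹` arc has two sides locally, and the hull fills exactly one.)
* `IsArcHull.exists_accessArc` — **interior points are accessible from the base by simple
  arcs**: for a hull `A` bounded by a Jordan arc and `p ∈ int A` there is a simple arc from a
  real point of `A` to `p` with all its other points in `int A` — stated with the simple arc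
  unfolded as a map continuous and injective on `[0, 1]` (the form of
  `Literature.Topology.PlaneTopology.IsSimpleArc`, `Crosscut.lean`, which is not imported here). (`int A` is open and
  connected — `IsArcHull.isPreconnected_interior` — hence arcwise connected, and real points of
  the base strictly between the endpoints of `γ` are centres of discs whose upper halves lie in
  `int A`, `IsArcHull.exists_sides_interior_eq`.)

Both are folklore; neither is stated in [LSW], whose proof of Lemma 6.3 is probabilistic.
-/

noncomputable section

open Set Filter Metric Complex
open _root_.Topology
open UpperHalfPlane (upperHalfPlaneSet isOpen_upperHalfPlaneSet)
open scoped NNReal ComplexConjugate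

namespace Literature.Probability.RandomPlanarGeometry

/-- NAMED FACT — **existence of smooth hit paths.** For a smooth hull `A` with boundary arc
`γ` (`IsSmoothHullWith A γ γ'`) and `s₀ ∈ (0, 1)` there are `β β'` with
`IsSmoothHitPath A γ γ' s₀ β β'` (a `C¹` path in `A`, interior except for its endpoint
`β 1 = γ s₀`, meeting the boundary arc orthogonally) which is moreover injective on `[0, 1]`.
The inward normal segment at `γ(s₀)` of small length is such a path. [folklore] -/
def IsSmoothHullWith.exists_smoothHitPath : Prop :=
  ∀ {A : Set ℂ} {γ γ' : ℝ → ℂ}, IsSmoothHullWith A γ γ' → ∀ {s₀ : ℝ}, s₀ ∈ Ioo (0 : ℝ) 1 →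
    ∃ β β' : ℝ → ℂ, IsSmoothHitPath A γ γ' s₀ β β' ∧ InjOn β (Icc 0 1)

/-- NAMED FACT — **interior points of an arc hull are accessible from the base by simple
arcs.** For a hull `A` bounded by a Jordan arc (`IsArcHull A`) and `p ∈ int A` there is a path
`η : [0, 1] → ℂ`, continuous and injective on `[0, 1]`, from a real point `η 0 = x_b` of `A` to
`η 1 = p`, with `η u ∈ int A` for `0 < u ≤ 1`. [folklore] -/
def IsArcHull.exists_accessArc : Prop :=
  ∀ {A : Set ℂ}, IsArcHull A → ∀ {p : ℂ}, p ∈ interior A →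
    ∃ (η : ℝ → ℂ) (xb : ℝ), ContinuousOn η (Icc 0 1) ∧ InjOn η (Icc 0 1) ∧ η 0 = xb ∧ η 1 = p ∧
      ((xb : ℝ) : ℂ) ∈ A ∧ ∀ u ∈ Ioc (0 : ℝ) 1, η u ∈ interior A

/-! ### Small API -/

/-- An access arc lies in the hull. [folklore] -/
theorem accessArc_subset {A : Set ℂ} {η : ℝ → ℂ} {xb : ℝ} (h0 : η 0 = xb) (hxb : ((xb : ℝ) : ℂ) ∈ A)
    (hint : ∀ u ∈ Ioc (0 : ℝ) 1, η u ∈ interior A) : η '' Icc 0 1 ⊆ A := by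
  rintro _ ⟨u, hu, rfl⟩
  rcases hu.1.eq_or_lt with h | h
  · rw [← h, h0]; exact hxb
  · exact interior_subset (hint u ⟨h, hu.2⟩)

/-- The points of an access arc other than its base point lie in the open upper half-plane:
`int A ⊆ ℍ` is the tree lemma `IsBoundedHull.interior_subset` (`ArcHullInterior`); membership
form. [folklore] -/
theorem im_pos_of_mem_interior_hull {A : Set ℂ} (hA : IsBoundedHull A) {z : ℂ} (hz : z ∈ interior A) :
    0 < z.im :=
  hA.interior_subset hz

end Literature.Probability.RandomPlanarGeometry
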